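import Summits.Ventures.LatticeQCDFlow.Scaling.WarmStartCeiling
import Literature.Probability.MarkovChains.ProductTotalVariation
import Literature.Probability.MarkovChains.RandomTimeTotalVariation

/-!
HONEST FRAMING: exact (Metropolis-corrected) sampling algorithms for lattice gauge theory; figures
of merit are autocorrelation/cost numbers at stated couplings and volumes; no continuum-physics
claim.

# WarmStartHybrid — WARM STARTS FROM ARBITRARY AND FROM APPROXIMATE REPLICAS: IF THE REPLICAS IN `D₀` CARRY ANY PRODUCT
# LAW AND THE OTHERS ARE EXACT, `‖λPⁿ − π̃‖_TV ≤ ((2·#(D₀∖{0}) + p·𝟙{0∈D₀})/p)·(1 − tcp/(2m))ⁿ`; IF THE OTHERS ARE ONLY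
# `ε_j`-CLOSE TO `μ_j`, ADD `Σ_{j∉D₀} ε_j` (lean-2 GEN-27, ours)

Venture-side (OURS).  Cell `lqcd-flow` (pub-lqcd), unit `pub-lqcd-lean-2-g27`, 2026-08-27/28.  Chapter M, file 25 —
`OPEN-MATH-chapterM.md` item 4.  Setting of `Scaling/WarmStartCeiling` (hub list `e_r = (0, κ_r+1)`, maps `φ_r`,
positive unit-mass laws `μ_k`, exact hot sampler, stationary cold kernels, one-sided domination `p`, regime
`4t ≤ p(1−t)w_0`, multiplicities `≥ c ≥ 1`).  `Scaling/WarmStartCeiling` pins the replicas in `D₀` at one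
configuration `x`; here they carry ANY product law (`g_j` arbitrary non-negative unit-mass for `j ∈ D₀`, `g_j = μ_j`
off `D₀`), by convexity: `⊗g = Σ_x (⊗g)(x)·λ₀^{(x)}` is a mixture of pinned starts, the pinned bound does not depend
on `x`, and `λ ↦ ‖λPⁿ − π̃‖_TV` is convex.  Replicas off `D₀` that are only `ε_j`-close to `μ_j` in total variation
cost `Σ_{j∉D₀} ε_j` more (`‖⊗g' − ⊗g‖_TV ≤ Σ_j ‖g'_j − g_j‖_TV`, Levin–Peres Exercise 4.4, and the contraction
`‖λPⁿ − λ'Pⁿ‖_TV ≤ ‖λ − λ'‖_TV`).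

## What is proved

* §1 (generic) `lawAt_mixture`, **`tvDist_lawAt_le_of_mixture`** — a bound on `‖λ_iPⁿ − π‖_TV` common to the
  components of a mixture `λ = Σ_i a_iλ_i` holds for `λ`; with the contraction `‖λPⁿ − λ'Pⁿ‖_TV ≤ ‖λ − λ'‖_TV`
  (`Literature…RandomTimeTotalVariation.tvDist_lawAt_lawAt_le`) **`tvDist_lawAt_le_of_close_start`** — `‖λ'Pⁿ − π‖_TV ≤ ‖λ' − λ‖_TV + ‖λPⁿ − π‖_TV`.
* §2 `hybridLaw_eq_mixture` — `⊗g = Σ_x (⊗g)(x)·⊗g^{pin,x}`; **`hybridStart_tvDist_le`** — arbitrary laws on `D₀`,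
  exact off `D₀`: `‖(⊗g)Pⁿ − π̃‖_TV ≤ ((2·#(D₀∖{0}) + p·𝟙{0 ∈ D₀})/p)·(1 − tcp/(2m))ⁿ`.
* §3 **`approxStart_tvDist_le`** — arbitrary laws on `D₀`, `‖g'_j − μ_j‖_TV ≤ ε_j` off `D₀`:
  `‖(⊗g')Pⁿ − π̃‖_TV ≤ Σ_{j∉D₀} ε_j + ((2·#(D₀∖{0}) + p·𝟙{0 ∈ D₀})/p)·(1 − tcp/(2m))ⁿ`.
* §4 the times: **`hybridStart_tvDist_le_of_ge_log`** (`≤ ε` once `n ≥ (2m/(tcp))·log((2·#(D₀∖{0}) + p·𝟙{0∈D₀})/(pε))`),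
  **`approxStart_tvDist_le_of_ge_log`** (`≤ Σ_{j∉D₀} ε_j + ε` at the same time), `uniformApproxStart_tvDist_le_of_ge_log`
  (`m = cK`: the time is `(2K/(tp))·log(…)`).

Reading (no numerics implied): a tempering restart in which `j` replicas are re-initialised ANYHOW (not at one
configuration) and the others come from well-mixed but imperfect runs is within `ε + Σ ε_j` of `π̃` after
`(2m/(tcp))·log((2j+p)/(pε))` steps.  NOT CLAIMED: correlated (non-product) initial laws beyond the mixture
argument; the regime restriction for imperfect maps; anything measured.  Literature grade (cell rule): OWN RESULT
(convexity + `Literature.Probability.MarkovChains.ProductTotalVariation`); nothing cited as a fact; no new bib keys.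
-/

noncomputable section

open Finset Function
open Literature.Probability.MarkovChains

namespace Summit.Ventures.LatticeQCDFlow.Scaling

/-! ## §1 Mixtures and close starts (generic) -/

section Generic
variable {X : Type*} [Fintype X] [DecidableEq X] {ι : Type*} [Fintype ι]

/-- The law at time `n` is linear in the initial law: `(Σ_i a_iλ_i)Pⁿ = Σ_i a_i(λ_iPⁿ)`. [ours] -/
theorem lawAt_mixture (P : X → X → ℝ) (a : ι → ℝ) (μs : ι → X → ℝ) {μ : X → ℝ}
    (hμ : ∀ y, μ y = ∑ i, a i * μs i y) (n : ℕ) (y : X) :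
    lawAt P μ n y = ∑ i, a i * lawAt P (μs i) n y := by
  rw [lawAt_eq_sum_mul_lawAt_single]
  simp_rw [lawAt_eq_sum_mul_lawAt_single P (μs _) n y, hμ, Finset.sum_mul, Finset.mul_sum]
  rw [Finset.sum_comm]
  exact Finset.sum_congr rfl fun i _ => Finset.sum_congr rfl fun x _ => by ring

/-- **CONVEXITY:** if `λ = Σ_i a_iλ_i` with `a ≥ 0`, `Σ_i a_i = 1`, and every component has `‖λ_iPⁿ − π‖_TV ≤ B`, then
`‖λPⁿ − π‖_TV ≤ B`. [ours] -/
theorem tvDist_lawAt_le_of_mixture (P : X → X → ℝ) (π : X → ℝ) {a : ι → ℝ} (ha0 : ∀ i, 0 ≤ a i)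
    (ha1 : ∑ i, a i = 1) (μs : ι → X → ℝ) {μ : X → ℝ} (hμ : ∀ y, μ y = ∑ i, a i * μs i y) {B : ℝ} (n : ℕ)
    (hB : ∀ i, tvDist (lawAt P (μs i) n) π ≤ B) : tvDist (lawAt P μ n) π ≤ B := by
  have hpt : ∀ y, |lawAt P μ n y - π y| ≤ ∑ i, a i * |lawAt P (μs i) n y - π y| := by
    intro y
    have h1 : lawAt P μ n y - π y = ∑ i, a i * (lawAt P (μs i) n y - π y) := by
      rw [lawAt_mixture P a μs hμ n y]
      simp only [mul_sub, sum_sub_distrib, ← sum_mul, ha1, one_mul]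
    rw [h1]
    refine (abs_sum_le_sum_abs _ _).trans (le_of_eq (sum_congr rfl fun i _ => ?_))
    rw [abs_mul, abs_of_nonneg (ha0 i)]
  calc tvDist (lawAt P μ n) π
      = (1 / 2) * ∑ y, |lawAt P μ n y - π y| := rfl
    _ ≤ (1 / 2) * ∑ y, ∑ i, a i * |lawAt P (μs i) n y - π y| :=
        mul_le_mul_of_nonneg_left (sum_le_sum fun y _ => hpt y) (by norm_num)
    _ = ∑ i, a i * tvDist (lawAt P (μs i) n) π := by
        rw [sum_comm, mul_sum]
        refine sum_congr rfl fun i _ => ?_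
        unfold tvDist
        rw [mul_sum, mul_sum, mul_sum]
        exact sum_congr rfl fun y _ => by ring
    _ ≤ ∑ i, a i * B := sum_le_sum fun i _ => mul_le_mul_of_nonneg_left (hB i) (ha0 i)
    _ = B := by rw [← sum_mul, ha1, one_mul]

omit [DecidableEq X] in
/-- **CLOSE STARTS:** `‖λ'Pⁿ − π‖_TV ≤ ‖λ' − λ‖_TV + ‖λPⁿ − π‖_TV`. [ours] -/
theorem tvDist_lawAt_le_of_close_start {P : X → X → ℝ} (hP : IsRowStochastic P) (π μ ν : X → ℝ) (n : ℕ) :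
    tvDist (lawAt P ν n) π ≤ tvDist ν μ + tvDist (lawAt P μ n) π :=
  (tvDist_triangle _ (lawAt P μ n) _).trans (by linarith [tvDist_lawAt_lawAt_le hP ν μ n])

end Generic

/-! ## §2 Arbitrary laws on `D₀`, exact off `D₀` -/

variable {S : Type*} [Fintype S] [DecidableEq S] {K m : ℕ} {μ : Fin (K + 1) → S → ℝ} {M : Fin (K + 1) → S → S → ℝ}
  {w : Fin (K + 1) → ℝ} {t p : ℝ}

section Hybrid
variable (κ : Fin m → Fin K) (φ : Fin m → Equiv.Perm S)

omit [DecidableEq S] in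
/-- **THE HYBRID START IS A MIXTURE OF PINNED STARTS: `⊗g = Σ_x (⊗g)(x)·⊗g^{pin,x}`** (`g_j` arbitrary of unit mass on
`D₀`, `g_j = μ_j` off `D₀`; `g^{pin,x}_j = δ_{x_j}` on `D₀`, `μ_j` off `D₀`). [ours] -/
theorem hybridLaw_eq_mixture [DecidableEq S] (D₀ : Finset (Fin (K + 1)))
    {g : Fin (K + 1) → S → ℝ} (hgoff : ∀ j, j ∉ D₀ → ∀ u, g j u = μ j u) (hg1 : ∀ j, ∑ u, g j u = 1)
    {gpin : (Fin (K + 1) → S) → Fin (K + 1) → S → ℝ}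
    (hgpin : ∀ x j u, gpin x j u = if j ∈ D₀ then (if u = x j then (1 : ℝ) else 0) else μ j u)
    (z : Fin (K + 1) → S) :
    tensorFun g z = ∑ x : Fin (K + 1) → S, tensorFun g x * tensorFun (gpin x) z := by
  -- as a function of `x`, `⊗g^{pin,x}(z) = ⊗h(x)` with `h_j(v) = 𝟙{z_j = v}` on `D₀`, `μ_j(z_j)` off `D₀`
  set h : Fin (K + 1) → S → ℝ := fun j v => if j ∈ D₀ then (if z j = v then (1 : ℝ) else 0) else μ j (z j) with hh
  have hpin : ∀ x, tensorFun (gpin x) z = tensorFun h x := fun x => by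
    unfold tensorFun
    exact Finset.prod_congr rfl fun j _ => by rw [hgpin, hh]
  simp_rw [hpin, tensorFun_mul, sum_tensorFun]
  unfold tensorFun
  refine Finset.prod_congr rfl fun j _ => ?_
  by_cases hj : j ∈ D₀
  · simp_rw [hh, if_pos hj, mul_ite, mul_one, mul_zero]
    rw [Finset.sum_ite_eq univ (z j), if_pos (mem_univ _)]
  · simp_rw [hh, if_neg hj, ← Finset.sum_mul, hg1 j, one_mul, hgoff j hj]

/-- **THE WARM START FROM ARBITRARY REPLICAS ON `D₀`:** `g_j ≥ 0` of unit mass for `j ∈ D₀` (anything), `g_j = μ_j`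
off `D₀`; one-sided domination `p`, `4t ≤ p(1−t)w_0`, exact hot sampler, stationary cold kernels, multiplicities
`≥ c ≥ 1`: **`‖(⊗g)Pⁿ − π̃‖_TV ≤ ((2·#(D₀∖{0}) + p·𝟙{0 ∈ D₀})/p)·(1 − tcp/(2m))ⁿ`.** [ours] -/
theorem hybridStart_tvDist_le (hm : 1 ≤ m) (ht0 : 0 ≤ t) (ht1 : t ≤ 1) (hw0 : ∀ k, 0 ≤ w k) (hw1 : ∑ k, w k = 1)
    (hμ : ∀ k x, 0 < μ k x) (hμ1 : ∀ k, ∑ u, μ k u = 1) (hM : ∀ k, IsRowStochastic (M k))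
    (hM0 : ∀ u v, M 0 u v = μ 0 v) (hstat : ∀ k : Fin (K + 1), k ≠ 0 → ∀ v, ∑ u, μ k u * M k u v = μ k v)
    (hp0 : 0 < p) (hp1 : p ≤ 1) (hdom : ∀ r u, p * μ (κ r).succ (φ r u) ≤ μ 0 u) (hreg : 4 * t ≤ p * (1 - t) * w 0)
    {c : ℕ} (hc1 : 1 ≤ c) (hc : ∀ p' : Fin K, c ≤ (univ.filter (fun r : Fin m => κ r = p')).card) (hcm : c ≤ m)
    (D₀ : Finset (Fin (K + 1))) {g : Fin (K + 1) → S → ℝ} (hg0 : ∀ j u, 0 ≤ g j u) (hg1 : ∀ j, ∑ u, g j u = 1)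
    (hgoff : ∀ j, j ∉ D₀ → ∀ u, g j u = μ j u) (n : ℕ) :
    tvDist (lawAt (fun y z : Fin (K + 1) → S =>
          t * ptGraphSwap μ (fun r : Fin m => (((0 : Fin (K + 1)), (κ r).succ) : Fin (K + 1) × Fin (K + 1))) φ y z
          + (1 - t) * prodKernel w M y z) (tensorFun g) n) (tensorFun μ)
      ≤ (2 * ((D₀.erase 0).card : ℝ) + p * (if (0 : Fin (K + 1)) ∈ D₀ then (1 : ℝ) else 0)) / p
          * (1 - t * c * p / (2 * m)) ^ n := by
  set gpin : (Fin (K + 1) → S) → Fin (K + 1) → S → ℝ :=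
    fun x j u => if j ∈ D₀ then (if u = x j then (1 : ℝ) else 0) else μ j u with hgpin_def
  have hgpin : ∀ x j u, gpin x j u = if j ∈ D₀ then (if u = x j then (1 : ℝ) else 0) else μ j u := fun _ _ _ => rfl
  refine tvDist_lawAt_le_of_mixture _ _ (a := tensorFun g) (fun x => ?_) (sum_tensorFun_eq_one g hg1)
    (fun x => tensorFun (gpin x)) (hybridLaw_eq_mixture D₀ hgoff hg1 hgpin) n (fun x => ?_)
  · unfold tensorFun; exact Finset.prod_nonneg fun j _ => hg0 j (x j)
  · exact warmStart_tvDist_le κ φ hm ht0 ht1 hw0 hw1 hμ hμ1 hM hM0 hstat hp0 hp1 hdom hreg hc1 hc hcm D₀ x (hgpin x) n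

/-! ## §3 Approximate replicas off `D₀` -/

/-- **THE WARM START FROM APPROXIMATE REPLICAS:** `g'_j ≥ 0` of unit mass at every level, arbitrary on `D₀` and with
`‖g'_j − μ_j‖_TV ≤ ε_j` off `D₀`; then **`‖(⊗g')Pⁿ − π̃‖_TV ≤ Σ_{j∉D₀} ε_j + ((2·#(D₀∖{0}) + p·𝟙{0 ∈ D₀})/p)·(1 − tcp/(2m))ⁿ`.**
[ours] -/
theorem approxStart_tvDist_le (hm : 1 ≤ m) (ht0 : 0 ≤ t) (ht1 : t ≤ 1) (hw0 : ∀ k, 0 ≤ w k) (hw1 : ∑ k, w k = 1)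
    (hμ : ∀ k x, 0 < μ k x) (hμ1 : ∀ k, ∑ u, μ k u = 1) (hM : ∀ k, IsRowStochastic (M k))
    (hM0 : ∀ u v, M 0 u v = μ 0 v) (hstat : ∀ k : Fin (K + 1), k ≠ 0 → ∀ v, ∑ u, μ k u * M k u v = μ k v)
    (hp0 : 0 < p) (hp1 : p ≤ 1) (hdom : ∀ r u, p * μ (κ r).succ (φ r u) ≤ μ 0 u) (hreg : 4 * t ≤ p * (1 - t) * w 0)
    {c : ℕ} (hc1 : 1 ≤ c) (hc : ∀ p' : Fin K, c ≤ (univ.filter (fun r : Fin m => κ r = p')).card) (hcm : c ≤ m)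
    (D₀ : Finset (Fin (K + 1))) {g' : Fin (K + 1) → S → ℝ} (hg0 : ∀ j u, 0 ≤ g' j u) (hg1 : ∀ j, ∑ u, g' j u = 1)
    {ε : Fin (K + 1) → ℝ} (hε : ∀ j, j ∉ D₀ → tvDist (g' j) (μ j) ≤ ε j) (n : ℕ) :
    tvDist (lawAt (fun y z : Fin (K + 1) → S =>
          t * ptGraphSwap μ (fun r : Fin m => (((0 : Fin (K + 1)), (κ r).succ) : Fin (K + 1) × Fin (K + 1))) φ y z
          + (1 - t) * prodKernel w M y z) (tensorFun g') n) (tensorFun μ)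
      ≤ ∑ j ∈ univ.filter (fun j => j ∉ D₀), ε j
        + (2 * ((D₀.erase 0).card : ℝ) + p * (if (0 : Fin (K + 1)) ∈ D₀ then (1 : ℝ) else 0)) / p
          * (1 - t * c * p / (2 * m)) ^ n := by
  -- the hybrid law `g` (= `g'` on `D₀`, `μ` off `D₀`)
  set g : Fin (K + 1) → S → ℝ := fun j u => if j ∈ D₀ then g' j u else μ j u with hg_def
  have hG0 : ∀ j u, 0 ≤ g j u := fun j u => by rw [hg_def]; dsimp only; split_ifs; exacts [hg0 j u, (hμ j u).le]
  have hG1 : ∀ j, ∑ u, g j u = 1 := fun j => by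
    simp only [hg_def]; split_ifs; exacts [hg1 j, hμ1 j]
  have hGoff : ∀ j, j ∉ D₀ → ∀ u, g j u = μ j u := fun j hj u => by simp only [hg_def, if_neg hj]
  have hP : IsRowStochastic (fun y z : Fin (K + 1) → S =>
      t * ptGraphSwap μ (fun r : Fin m => (((0 : Fin (K + 1)), (κ r).succ) : Fin (K + 1) × Fin (K + 1))) φ y z
      + (1 - t) * prodKernel w M y z) :=
    weightedScheme_isRowStochastic (ptGraphSwap_isRowStochastic hμ) hM hw0 hw1 ht0 ht1
  have hclose : tvDist (tensorFun g') (tensorFun g) ≤ ∑ j ∈ univ.filter (fun j => j ∉ D₀), ε j := by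
    refine (LevinPeres2017_exercise_4_4 hg0 hG0 hg1 hG1).trans ?_
    rw [← Finset.sum_filter_add_sum_filter_not univ (fun j : Fin (K + 1) => j ∉ D₀)]
    have hzero : ∑ j ∈ univ.filter (fun j : Fin (K + 1) => ¬ j ∉ D₀), tvDist (g' j) (g j) = 0 := by
      refine Finset.sum_eq_zero fun j hj => ?_
      have hj' : j ∈ D₀ := not_not.mp (Finset.mem_filter.mp hj).2
      have : g j = g' j := funext fun u => by simp only [hg_def, if_pos hj']
      rw [this, tvDist_self]
    rw [hzero, add_zero]
    refine Finset.sum_le_sum fun j hj => ?_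
    have hj' : j ∉ D₀ := (Finset.mem_filter.mp hj).2
    have : g j = μ j := funext fun u => hGoff j hj' u
    rw [this]; exact hε j hj'
  have hhyb := hybridStart_tvDist_le κ φ hm ht0 ht1 hw0 hw1 hμ hμ1 hM hM0 hstat hp0 hp1 hdom hreg hc1 hc hcm D₀ hG0 hG1
    hGoff n
  exact (tvDist_lawAt_le_of_close_start hP _ (tensorFun g) (tensorFun g') n).trans (add_le_add hclose hhyb)

/-! ## §4 The warm-start times -/

/-- **THE TIME FROM ARBITRARY REPLICAS ON `D₀`: `‖(⊗g)Pⁿ − π̃‖_TV ≤ ε` ONCE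
`n ≥ (2m/(tcp))·log((2·#(D₀∖{0}) + p·𝟙{0∈D₀})/(pε))`** (`0 < t`, `D₀` non-empty). [ours] -/
theorem hybridStart_tvDist_le_of_ge_log (hm : 1 ≤ m) (ht0 : 0 < t) (ht1 : t ≤ 1) (hw0 : ∀ k, 0 ≤ w k)
    (hw1 : ∑ k, w k = 1) (hμ : ∀ k x, 0 < μ k x) (hμ1 : ∀ k, ∑ u, μ k u = 1) (hM : ∀ k, IsRowStochastic (M k))
    (hM0 : ∀ u v, M 0 u v = μ 0 v) (hstat : ∀ k : Fin (K + 1), k ≠ 0 → ∀ v, ∑ u, μ k u * M k u v = μ k v)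
    (hp0 : 0 < p) (hp1 : p ≤ 1) (hdom : ∀ r u, p * μ (κ r).succ (φ r u) ≤ μ 0 u) (hreg : 4 * t ≤ p * (1 - t) * w 0)
    {c : ℕ} (hc1 : 1 ≤ c) (hc : ∀ p' : Fin K, c ≤ (univ.filter (fun r : Fin m => κ r = p')).card) (hcm : c ≤ m)
    (D₀ : Finset (Fin (K + 1))) (hD₀ : D₀.Nonempty) {g : Fin (K + 1) → S → ℝ} (hg0 : ∀ j u, 0 ≤ g j u)
    (hg1 : ∀ j, ∑ u, g j u = 1) (hgoff : ∀ j, j ∉ D₀ → ∀ u, g j u = μ j u) {ε : ℝ} (hε : 0 < ε) {n : ℕ}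
    (hn : 2 * (m : ℝ) / (t * c * p) * Real.log ((2 * ((D₀.erase 0).card : ℝ) + p * (if (0 : Fin (K + 1)) ∈ D₀ then (1 : ℝ) else 0)) / (p * ε)) ≤ n) :
    tvDist (lawAt (fun y z : Fin (K + 1) → S =>
          t * ptGraphSwap μ (fun r : Fin m => (((0 : Fin (K + 1)), (κ r).succ) : Fin (K + 1) × Fin (K + 1))) φ y z
          + (1 - t) * prodKernel w M y z) (tensorFun g) n) (tensorFun μ) ≤ ε := by
  set gpin : (Fin (K + 1) → S) → Fin (K + 1) → S → ℝ :=
    fun x j u => if j ∈ D₀ then (if u = x j then (1 : ℝ) else 0) else μ j u with hgpin_def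
  have hgpin : ∀ x j u, gpin x j u = if j ∈ D₀ then (if u = x j then (1 : ℝ) else 0) else μ j u := fun _ _ _ => rfl
  refine tvDist_lawAt_le_of_mixture _ _ (a := tensorFun g) (fun x => ?_) (sum_tensorFun_eq_one g hg1)
    (fun x => tensorFun (gpin x)) (hybridLaw_eq_mixture D₀ hgoff hg1 hgpin) n (fun x => ?_)
  · unfold tensorFun; exact Finset.prod_nonneg fun j _ => hg0 j (x j)
  · exact warmStart_tvDist_le_of_ge_log κ φ hm ht0 ht1 hw0 hw1 hμ hμ1 hM hM0 hstat hp0 hp1 hdom hreg hc1 hc hcm D₀ hD₀ x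
      (hgpin x) hε hn

/-- **THE TIME FROM APPROXIMATE REPLICAS: `‖(⊗g')Pⁿ − π̃‖_TV ≤ Σ_{j∉D₀} ε_j + ε` ONCE
`n ≥ (2m/(tcp))·log((2·#(D₀∖{0}) + p·𝟙{0∈D₀})/(pε))`** (`g'_j` arbitrary on `D₀`, `ε_j`-close to `μ_j` off `D₀`;
`0 < t`, `D₀` non-empty). [ours] -/
theorem approxStart_tvDist_le_of_ge_log (hm : 1 ≤ m) (ht0 : 0 < t) (ht1 : t ≤ 1) (hw0 : ∀ k, 0 ≤ w k)
    (hw1 : ∑ k, w k = 1) (hμ : ∀ k x, 0 < μ k x) (hμ1 : ∀ k, ∑ u, μ k u = 1) (hM : ∀ k, IsRowStochastic (M k))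
    (hM0 : ∀ u v, M 0 u v = μ 0 v) (hstat : ∀ k : Fin (K + 1), k ≠ 0 → ∀ v, ∑ u, μ k u * M k u v = μ k v)
    (hp0 : 0 < p) (hp1 : p ≤ 1) (hdom : ∀ r u, p * μ (κ r).succ (φ r u) ≤ μ 0 u) (hreg : 4 * t ≤ p * (1 - t) * w 0)
    {c : ℕ} (hc1 : 1 ≤ c) (hc : ∀ p' : Fin K, c ≤ (univ.filter (fun r : Fin m => κ r = p')).card) (hcm : c ≤ m)
    (D₀ : Finset (Fin (K + 1))) (hD₀ : D₀.Nonempty) {g' : Fin (K + 1) → S → ℝ} (hg0 : ∀ j u, 0 ≤ g' j u)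
    (hg1 : ∀ j, ∑ u, g' j u = 1) {εj : Fin (K + 1) → ℝ} (hεj : ∀ j, j ∉ D₀ → tvDist (g' j) (μ j) ≤ εj j)
    {ε : ℝ} (hε : 0 < ε) {n : ℕ}
    (hn : 2 * (m : ℝ) / (t * c * p) * Real.log ((2 * ((D₀.erase 0).card : ℝ) + p * (if (0 : Fin (K + 1)) ∈ D₀ then (1 : ℝ) else 0)) / (p * ε)) ≤ n) :
    tvDist (lawAt (fun y z : Fin (K + 1) → S =>
          t * ptGraphSwap μ (fun r : Fin m => (((0 : Fin (K + 1)), (κ r).succ) : Fin (K + 1) × Fin (K + 1))) φ y z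
          + (1 - t) * prodKernel w M y z) (tensorFun g') n) (tensorFun μ) ≤ ∑ j ∈ univ.filter (fun j => j ∉ D₀), εj j + ε := by
  -- the hybrid law `g` (= `g'` on `D₀`, `μ` off `D₀`)
  set g : Fin (K + 1) → S → ℝ := fun j u => if j ∈ D₀ then g' j u else μ j u with hg_def
  have hG0 : ∀ j u, 0 ≤ g j u := fun j u => by rw [hg_def]; dsimp only; split_ifs; exacts [hg0 j u, (hμ j u).le]
  have hG1 : ∀ j, ∑ u, g j u = 1 := fun j => by
    simp only [hg_def]; split_ifs; exacts [hg1 j, hμ1 j]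
  have hGoff : ∀ j, j ∉ D₀ → ∀ u, g j u = μ j u := fun j hj u => by simp only [hg_def, if_neg hj]
  have hP : IsRowStochastic (fun y z : Fin (K + 1) → S =>
          t * ptGraphSwap μ (fun r : Fin m => (((0 : Fin (K + 1)), (κ r).succ) : Fin (K + 1) × Fin (K + 1))) φ y z
          + (1 - t) * prodKernel w M y z) :=
    weightedScheme_isRowStochastic (ptGraphSwap_isRowStochastic hμ) hM hw0 hw1 ht0.le ht1
  have hclose : tvDist (tensorFun g') (tensorFun g) ≤ ∑ j ∈ univ.filter (fun j => j ∉ D₀), εj j := by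
    refine (LevinPeres2017_exercise_4_4 hg0 hG0 hg1 hG1).trans ?_
    rw [← Finset.sum_filter_add_sum_filter_not univ (fun j : Fin (K + 1) => j ∉ D₀)]
    have hzero : ∑ j ∈ univ.filter (fun j : Fin (K + 1) => ¬ j ∉ D₀), tvDist (g' j) (g j) = 0 := by
      refine Finset.sum_eq_zero fun j hj => ?_
      have hj' : j ∈ D₀ := not_not.mp (Finset.mem_filter.mp hj).2
      have : g j = g' j := funext fun u => by simp only [hg_def, if_pos hj']
      rw [this, tvDist_self]
    rw [hzero, add_zero]
    refine Finset.sum_le_sum fun j hj => ?_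
    have hj' : j ∉ D₀ := (Finset.mem_filter.mp hj).2
    have : g j = μ j := funext fun u => hGoff j hj' u
    rw [this]; exact hεj j hj'
  have hhyb := hybridStart_tvDist_le_of_ge_log κ φ hm ht0 ht1 hw0 hw1 hμ hμ1 hM hM0 hstat hp0 hp1 hdom hreg hc1 hc hcm D₀
    hD₀ hG0 hG1 hGoff hε hn
  exact (tvDist_lawAt_le_of_close_start hP _ (tensorFun g) (tensorFun g') n).trans (add_le_add hclose hhyb)

/-- **UNIFORM LISTING (`m = cK`, every multiplicity `≥ c`): `‖(⊗g')Pⁿ − π̃‖_TV ≤ Σ_{j∉D₀} ε_j + ε` ONCE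
`n ≥ (2K/(tp))·log((2·#(D₀∖{0}) + p·𝟙{0∈D₀})/(pε))`** — `j` replicas restarted anyhow, the rest `ε_j`-close: back
within `ε + Σε_j` after `(2K/(tp))·log((2j+p)/(pε))` steps. [ours] -/
theorem uniformApproxStart_tvDist_le_of_ge_log (hK : 1 ≤ K) (ht0 : 0 < t) (ht1 : t ≤ 1) (hw0 : ∀ k, 0 ≤ w k)
    (hw1 : ∑ k, w k = 1) (hμ : ∀ k x, 0 < μ k x) (hμ1 : ∀ k, ∑ u, μ k u = 1) (hM : ∀ k, IsRowStochastic (M k))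
    (hM0 : ∀ u v, M 0 u v = μ 0 v) (hstat : ∀ k : Fin (K + 1), k ≠ 0 → ∀ v, ∑ u, μ k u * M k u v = μ k v)
    (hp0 : 0 < p) (hp1 : p ≤ 1) (hdom : ∀ r u, p * μ (κ r).succ (φ r u) ≤ μ 0 u) (hreg : 4 * t ≤ p * (1 - t) * w 0)
    {c : ℕ} (hc1 : 1 ≤ c) (hc : ∀ p' : Fin K, c ≤ (univ.filter (fun r : Fin m => κ r = p')).card) (hmc : m = c * K)
    (D₀ : Finset (Fin (K + 1))) (hD₀ : D₀.Nonempty) {g' : Fin (K + 1) → S → ℝ} (hg0 : ∀ j u, 0 ≤ g' j u)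
    (hg1 : ∀ j, ∑ u, g' j u = 1) {εj : Fin (K + 1) → ℝ} (hεj : ∀ j, j ∉ D₀ → tvDist (g' j) (μ j) ≤ εj j)
    {ε : ℝ} (hε : 0 < ε) {n : ℕ}
    (hn : 2 * (K : ℝ) / (t * p) * Real.log ((2 * ((D₀.erase 0).card : ℝ) + p * (if (0 : Fin (K + 1)) ∈ D₀ then (1 : ℝ) else 0)) / (p * ε)) ≤ n) :
    tvDist (lawAt (fun y z : Fin (K + 1) → S =>
          t * ptGraphSwap μ (fun r : Fin m => (((0 : Fin (K + 1)), (κ r).succ) : Fin (K + 1) × Fin (K + 1))) φ y z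
          + (1 - t) * prodKernel w M y z) (tensorFun g') n) (tensorFun μ) ≤ ∑ j ∈ univ.filter (fun j => j ∉ D₀), εj j + ε := by
  have hm : 1 ≤ m := by rw [hmc]; exact Nat.one_le_iff_ne_zero.mpr (Nat.mul_ne_zero (by omega) (by omega))
  have hcm : c ≤ m := by rw [hmc]; exact Nat.le_mul_of_pos_right c (by omega)
  have hcpos : (0 : ℝ) < c := Nat.cast_pos.mpr (by omega)
  have e : 2 * (m : ℝ) / (t * c * p) = 2 * (K : ℝ) / (t * p) := by
    rw [hmc, Nat.cast_mul]; field_simp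
  exact approxStart_tvDist_le_of_ge_log κ φ hm ht0 ht1 hw0 hw1 hμ hμ1 hM hM0 hstat hp0 hp1 hdom hreg hc1 hc hcm D₀ hD₀ hg0
    hg1 hεj hε (by rw [e]; exact hn)

end Hybrid

end Summit.Ventures.LatticeQCDFlow.Scaling

end
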